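import Mathlib
import Summits.ResolutionOfSingularities.ResolutionOfSingularities.Theorems.WildQuotientsWildQuotientResolutionZ9PeeledTerminalAway
import Summits.ResolutionOfSingularities.ResolutionOfSingularities.Theorems.WildQuotientsWildQuotientResolutionZ9PeeledTerminalKL
import Summits.ResolutionOfSingularities.ResolutionOfSingularities.Theorems.WildQuotientsWildQuotientResolutionZ9PeeledPieceMonomials
import Summits.ResolutionOfSingularities.ResolutionOfSingularities.Theorems.WildQuotientsWildQuotientResolutionZ9PeeledOrder
import Summits.ResolutionOfSingularities.ResolutionOfSingularities.Theorems.WildQuotientsWildQuotientResolutionZ9PeeledRootChartAPackage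
import Summits.ResolutionOfSingularities.ResolutionOfSingularities.Theorems.WildQuotientsWildQuotientResolutionPeelingFrameTrivialGrading
import Summits.ResolutionOfSingularities.ResolutionOfSingularities.Theorems.WildQuotientsWildQuotientResolutionZ9PeeledTerminalFixed
import Summits.ResolutionOfSingularities.ResolutionOfSingularities.Theorems.WildQuotientsWildQuotientResolutionZ9PeeledTerminalNorm

/-!
# The ℤ9 specimen, terminal piece `P₂ = D₊(N₂²⁸ t³)`: the Bergh–Rydh chart PACKAGE (Z4b (4-B)+(4-C))

(crux stmt-ResolutionOfSingularities-15640 `WildQuotients.WildQuotientResolution`, S1 = stmt-…-17941; ℤ9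
SPECIMEN brick Z4b/Z6 of res-L1-w45c-idea-2's `cardP_g12/Z9-SPECIMEN.md`; res-L1-w45c-stub-3's design
`L/res-L1-w45c-stub-3/Z4B-PART4-DESIGN.md` (4-B)/(4-C), «next session / taker» 2026-08-27T20:36:03Z;
res-L1-w45c-stub-1 TAKING 20:37:43Z. [OURS · L1 W4.5c] — assembly of landed decls, NOT a statement of any
manuscript: the SEAM `BlowupExit.exists_basicOpen_sectionsEquiv` (res-L1-w45c-lead-1) at the orbit norm
`N₂²⁸ t³ = normT 23` over res-D-pv-033's `piece_eq_basicOpen_normT`/`smul_norm_eq`, the ring model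
`exists_awayNorm_ringEquiv : (k[x][I₂₈ t])_{(normT 23)} ≃ L₂` and the terminal lift `σ̃` with its K–L regularity
with its fixed-point transfer `terminal_map_away_fixed_iff` and radicand lemmas `…TerminalNorm` (res-L1-w45c-stub-3), the trivial grading and the
transport lemma `Z9Peeled.exists_ringEquiv_invariants_of_seam` (res-L1-w45c-stub-1). Prover res-L1-w45c-stub-1.)

* `finite_zpowers_terminalLift` — `⟨σ̃⟩` is finite;
* **`terminal_package`** — THE `hchart` DATUM of `PeelingFrame.hasResolution_glued_liftAction_of_pieceGradedCharts`
  at the terminal piece `P2` (`P2.1 = ⨅ γ, (L γ)⁻¹ D₊(x_c²⁸ t)`): `S = L₂^⟨σ̃⟩` finite type, REGULAR, trivially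
  graded by `PUnit`, `e : 𝒮 0 ≃+* Γ(P2)^⟨σ̄⟩`, compatible with the `k`-structures.
-/

-- single-problem summit: the doubled namespace component `ResolutionOfSingularities` is forced
set_option linter.dupNamespace false

noncomputable section

open CategoryTheory AlgebraicGeometry TopologicalSpace MvPolynomial Polynomial HomogeneousLocalization
open Literature.AlgebraicGeometry.Resolution Literature.AlgebraicGeometry.RelativeSpec
open scoped Pointwise

namespace Summit.ResolutionOfSingularities.ResolutionOfSingularities.Theorems.WildQuotientResolution.Z9Peeled.Terminal

/-- Bookkeeping over ABSTRACT schemes (so that it elaborates cheaply; instantiating it on the chart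
avoids any rewriting inside the `Proj` section terms): if `q ≫ f = g` and `g^*|_⊤ z₀ = z₁` then
`(i ≫ π ≫ q)^* (f^*|_⊤ z₀) = (i ≫ π)^*|_{(i ≫ π ≫ q)⁻¹⊤} z₁`. [folklore] -/
theorem app_appLE_eq_of_comp_eq {P V A Y S : Scheme.{0}} (i : P ⟶ V) (π : V ⟶ A) (q : A ⟶ Y)
    (f : Y ⟶ S) (g : A ⟶ S) (hqf : q ≫ f = g) (z₀ : Γ(S, ⊤)) (z₁ : Γ(A, ⊤))
    (hz : g.appLE ⊤ ⊤ le_top z₀ = z₁) :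
    (i ≫ (π ≫ q)).app ⊤ (f.appLE ⊤ ⊤ le_top z₀) =
      (i ≫ π).appLE ⊤ ((i ≫ (π ≫ q)) ⁻¹ᵁ ⊤) (le_top.trans_eq (Opens.map_top _).symm) z₁ := by
  subst hqf; subst hz
  rw [app_comp_appLE_top,
    Literature.AlgebraicGeometry.Limits.appLE_congr_hom_apply (Category.assoc i π q ▸ (Category.assoc (i ≫ π) q f)),
    ← CommRingCat.comp_apply, Scheme.Hom.appLE_comp_appLE]

variable (k : Type) [Field k] (n : ℕ) (a b c d : Fin n)
  (hab : a ≠ b) (hac : a ≠ c) (had : a ≠ d) (hbc : b ≠ c) (hbd : b ≠ d) (hcd : c ≠ d)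

/-- The exponent table of the 24 generators of `I₂₈` (res-D-pv-033's `e24`, verbatim). -/
local notation3 "e24" => (![(4, 0, 0), (3, 2, 0), (3, 1, 3), (3, 0, 7), (2, 4, 0), (2, 3, 2), (2, 2, 6), (2, 1, 10), (2, 0, 14), (1, 6, 0), (1, 5, 1), (1, 4, 5), (1, 3, 9), (1, 2, 13), (1, 1, 17), (1, 0, 21), (0, 7, 0), (0, 6, 4), (0, 5, 8), (0, 4, 12), (0, 3, 16), (0, 2, 20), (0, 1, 24), (0, 0, 28)] : Fin 24 → ℕ × ℕ × ℕ)
/-- `v = 1 + s³ x_b′` (res-L1-w45c-stub-3's literal). -/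
local notation3 "v₂" => (1 + X c ^ 3 * X b : MvPolynomial (Fin n) k)
/-- `v' = 1 − s³ x_b′ + s⁶ x_a′`. -/
local notation3 "v₂'" => (1 - X c ^ 3 * X b + X c ^ 6 * X a : MvPolynomial (Fin n) k)
/-- `u₂ = v v'`. -/
local notation3 "u₂" => ((1 + X c ^ 3 * X b) * (1 - X c ^ 3 * X b + X c ^ 6 * X a) : MvPolynomial (Fin n) k)
/-- `L₂ = k[x][(v v')⁻¹]`. -/
local notation3 "L₂" => Localization.Away
  ((1 + X c ^ 3 * X b) * (1 - X c ^ 3 * X b + X c ^ 6 * X a) : MvPolynomial (Fin n) k)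
/-- `ι : k[x] → L₂`. -/
local notation3 "ι₂" => algebraMap (MvPolynomial (Fin n) k) (Localization.Away
  ((1 + X c ^ 3 * X b) * (1 - X c ^ 3 * X b + X c ^ 6 * X a) : MvPolynomial (Fin n) k))
/-- `iv = (ι v)⁻¹`. -/
local notation3 "iv₂" => (algebraMap (MvPolynomial (Fin n) k) (Localization.Away
  ((1 + X c ^ 3 * X b) * (1 - X c ^ 3 * X b + X c ^ 6 * X a) : MvPolynomial (Fin n) k))
    (1 - X c ^ 3 * X b + X c ^ 6 * X a) *
  (IsLocalization.Away.invSelf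
    ((1 + X c ^ 3 * X b) * (1 - X c ^ 3 * X b + X c ^ 6 * X a) : MvPolynomial (Fin n) k) :
    Localization.Away ((1 + X c ^ 3 * X b) * (1 - X c ^ 3 * X b + X c ^ 6 * X a) : MvPolynomial (Fin n) k)))
/-- The terminal substitution `ψ₂`: `x_a ↦ x_a′ s⁷`, `x_b ↦ x_b′ s⁴`, rest fixed. -/
local notation3 "tm₂" => (fun i : Fin n => if i = a then X a * X c ^ 7
    else if i = b then X b * X c ^ 4 else (X i : MvPolynomial (Fin n) k))
/-- the quotient map `q : 𝔸ⁿ → 𝔸ⁿ/⟨σ̄⟩` -/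
local notation3 "qq" σ => Spec.map (CommRingCat.ofHom (algebraMap
  (FixedPoints.subalgebra k (MvPolynomial (Fin n) k) ↥(Subgroup.zpowers σ)) (MvPolynomial (Fin n) k)))

/-- `⟨σ̃⟩` is finite (`σ̃³ = 1`, `σ̃ ≠ 1`). [folklore] -/
theorem finite_zpowers_terminalLift (σt : L₂ ≃ₐ[k] L₂) (hC : σt (ι₂ (X c)) = ι₂ (X c * v₂))
    (hσt3 : σt ^ 3 = 1) : Finite ↥(Subgroup.zpowers σt) := by
  haveI : Fact (Nat.Prime 3) := ⟨Nat.prime_three⟩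
  refine Nat.finite_of_card_ne_zero ?_
  rw [Nat.card_zpowers, orderOf_eq_prime hσt3 (terminalLift_ne_one k n a b c σt hC)]
  norm_num

/-! ## The package -/

include hab hac had hbc hbd hcd in
-- the statement is long (literal binder types of the scaffold); elaboration needs head-room
set_option maxHeartbeats 4000000 in
set_option synthInstance.maxHeartbeats 400000 in
/-- **The Bergh–Rydh chart package of the terminal piece `P₂ = D₊(N₂²⁸ t³)`** (the `hchart` datum of
`PeelingFrame.hasResolution_glued_liftAction_of_pieceGradedCharts` at `P2`): for the peeled action `σ̄`, the
scaffold of `V = Bl_{I₂₈} 𝔸ⁿ` and a stable affine piece `P2` with `P2.1 = ⨅ γ, (L γ)⁻¹ D₊(x_c²⁸ t)`, the ring of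
invariants `Γ(P2)^⟨σ̄⟩` is `≅ 𝒮 0 = S` for the finite-type REGULAR (char `3`, K–L) ring `S = L₂^⟨σ̃⟩`, trivially
graded, compatibly with the `k`-structures. [OURS · L1 W4.5c] [folklore; assembly of landed decls] -/
theorem terminal_package [CharP k 3] (g : Fin 24 → MvPolynomial (Fin n) k)
    (hg : ∀ q, g q = X a ^ (e24 q).1 * X b ^ (e24 q).2.1 * X c ^ (e24 q).2.2)
    (σ : MvPolynomial (Fin n) k ≃ₐ[k] MvPolynomial (Fin n) k) [Finite ↥(Subgroup.zpowers σ)]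
    (h0 : σ (X a) = X a) (hb : σ (X b) = X b + X a) (hc : σ (X c) = X c + X b)
    (hd : σ (X d) = X d + X c ^ 3 - X a ^ 2 * X c) (hσ : ∀ i, i ≠ b → i ≠ c → i ≠ d → σ (X i) = X i)
    (ρ : ↥(Subgroup.zpowers σ) →* Aut (Spec (CommRingCat.of (MvPolynomial (Fin n) k))))
    (hρ : ∀ γ : ↥(Subgroup.zpowers σ), (ρ γ).hom = Spec.map (CommRingCat.ofHom
      ((MulSemiringAction.toRingEquiv (↥(Subgroup.zpowers σ)) (MvPolynomial (Fin n) k) γ⁻¹ :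
        MvPolynomial (Fin n) k ≃+* MvPolynomial (Fin n) k) :
          MvPolynomial (Fin n) k →+* MvPolynomial (Fin n) k)))
    (hJ : ∀ γ : ↥(Subgroup.zpowers σ),
      (affineBlowup.idealSheaf (Ideal.span (Set.range g))).comap (ρ γ).hom =
        affineBlowup.idealSheaf (Ideal.span (Set.range g)))
    (ρB : ActionOver (affineBlowup.π (Ideal.span (Set.range g)) ≫ qq σ) ↥(Subgroup.zpowers σ))
    (hρB : ρB.aut = (affineBlowup.isBlowup (Ideal.span (Set.range g))).liftAction ρ hJ)
    (P2 : ρB.StableAffineOpens)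
    (hP2 : P2.1 = ⨅ γ : ↥(Subgroup.zpowers σ),
      (((affineBlowup.isBlowup (Ideal.span (Set.range g))).liftAction ρ hJ) γ).hom ⁻¹ᵁ
        (Proj.basicOpen (reesGrading (Ideal.span (Set.range g)))
          (reesT (I := Ideal.span (Set.range g)) (g 23) (Ideal.mem_span_range_self (f := g) (x := 23))))) :
    ∃ (A : Type) (_ : AddCommGroup A) (_ : Finite A) (_ : DecidableEq A)
      (S : Type) (_ : CommRing S) (_ : Algebra k S) (𝒮 : A → Submodule k S) (_ : GradedAlgebra 𝒮),
      Algebra.FiniteType k S ∧ IsRegularRing S ∧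
      ∃ e : ↥(𝒮 0) ≃+* ↥((ρB.restrict P2.1 P2.2.1).invariants.ring ⊤),
        ∀ c : k, ((e (algebraMap k (𝒮 0) c) :
            ↥((ρB.restrict P2.1 P2.2.1).invariants.ring ⊤)) :
              Γ(P2.1, (P2.1.ι ≫ (affineBlowup.π (Ideal.span (Set.range g)) ≫ qq σ)) ⁻¹ᵁ ⊤)) =
          (P2.1.ι ≫ (affineBlowup.π (Ideal.span (Set.range g)) ≫ qq σ)).app ⊤
            (((Spec.map (CommRingCat.ofHom (algebraMap k
              (FixedPoints.subalgebra k (MvPolynomial (Fin n) k) ↥(Subgroup.zpowers σ))))).appLE ⊤ ⊤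
              le_top) ((Scheme.ΓSpecIso (.of k)).inv c)) := by
  classical
  -- NB: no `obtain`/`rcases` on the (large) main goal — `Exists.elim` + projections instead (heartbeats)
  haveI : IsDomain L₂ := isDomain_L₂ k n a b c
  -- (0) `σ̄³ = 1`, the terminal lift `σ̃`
  have hσ3 : σ ^ 3 = 1 := pow_three_eq_one k n σ a b c d hab hac had hb hc hd hσ
  refine (exists_terminalLift k n a b c d σ hb hc hd hσ hσ3 hab hac had hbc hbd hcd).elim fun σt hσt => ?_
  have hC := hσt.1
  have hA := hσt.2.1
  have hB := hσt.2.2.1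
  have hD := hσt.2.2.2.1
  have hfix := hσt.2.2.2.2.1
  have hσt3 := hσt.2.2.2.2.2
  -- (1) the seam element `s = N₂²⁸ t³` and its radicand `w`
  have h23 : g 23 ∈ Ideal.span (Set.range g) := Ideal.mem_span_range_self (f := g) (x := 23)
  have h₁ : σ (g 23) ∈ Ideal.span (Set.range g) := sigma_apply_mem k n a b c g σ h0 hb hc hg _ h23
  have h₂ : σ (σ (g 23)) ∈ Ideal.span (Set.range g) := sigma_apply_mem k n a b c g σ h0 hb hc hg _ h₁
  let s : reesAlgebra (Ideal.span (Set.range g)) :=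
    reesT (g 23) h23 * reesT (σ (g 23)) h₁ * reesT (σ (σ (g 23))) h₂
  have hs3 : s ∈ reesGrading (Ideal.span (Set.range g)) 3 := by
    simpa using normT_mem k n a b c g σ h0 hb hc hg 23
  have hsw : ((s : reesAlgebra (Ideal.span (Set.range g))) : (MvPolynomial (Fin n) k)[X]) =
      monomial 3 (g 23 * σ (g 23) * σ (σ (g 23))) := coe_normT k n a b c g σ h0 hb hc hg 23
  have hg3 : (σ ^ 3) (g 23) = g 23 := pow_three_g23 k n a b c σ h0 hb hc g hg
  have hσw : σ (g 23 * σ (g 23) * σ (σ (g 23))) = g 23 * σ (g 23) * σ (σ (g 23)) :=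
    smul_norm_eq k n σ (g 23) hg3 ⟨σ, Subgroup.mem_zpowers σ⟩
  -- (2) the `φ`-family and the seam `Ω`
  refine (BlowupExit.exists_reesGradedHom_family (I := Ideal.span (Set.range g))
    (smul_I28_pointwise k n a b c σ h0 hb hc g hg)).elim fun φ hφf => ?_
  have hφ := hφf.1
  have hf := hφf.2
  have hφs : ∀ γ, φ γ s = s := by
    intro γ
    refine BlowupExit.reesGradedHom_eq_self_of_monomial _ (g 23 * σ (g 23) * σ (σ (g 23))) hsw (φ γ) _
      (hφ γ) ?_
    change (MulSemiringAction.toRingEquiv _ _ γ⁻¹) _ = _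
    rw [MulSemiringAction.toRingEquiv_apply_apply]
    exact smul_norm_eq k n σ (g 23) hg3 γ⁻¹
  have hP : ∀ γ, Submonoid.powers s ≤ (Submonoid.powers s).comap (φ γ) := by
    intro γ
    rintro _ ⟨m, rfl⟩
    exact ⟨m, by change _ ^ m = φ γ (_ ^ m); rw [map_pow, hφs γ]⟩
  have hOs : P2.1 = Proj.basicOpen (reesGrading (Ideal.span (Set.range g))) s :=
    hP2.trans (piece_eq_basicOpen_normT k n a b c g σ h0 hb hc hg 23 hg3 ρ hρ hJ)
  refine (BlowupExit.exists_basicOpen_sectionsEquiv ρ hρ hJ (qq σ) ρB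
    (fun γ => by rw [hρB]) s hs3 (by norm_num) φ hφ hf hφs hP P2.1 P2.2.1 hOs).elim fun Ω hΩ => ?_
  have hΩi := hΩ.1
  have hΩii := hΩ.2
  have hinv : ∀ y, Ω y ∈ (ρB.restrict P2.1 P2.2.1).invariantsRing ⊤ ↔
      ∀ γ, HomogeneousLocalization.map (φ γ) (hP γ) y = y := fun y =>
    BlowupExit.mem_invariantsRing_iff_of_sectionsEquiv (qq σ) ρB _ φ hP P2.1 P2.2.1 Ω hΩii y
  -- (3) the ring model `e₂ : (k[x][I₂₈ t])_{(s)} ≃ L₂` (res-L1-w45c-stub-3, part 4b)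
  have hg23 : g 23 = X c ^ 28 := by rw [hg 23]; simp
  have hr₁ : aeval tm₂ (σ (g 23)) = X c ^ 28 * v₂ ^ 28 := by
    rw [hg23]; exact term_sigma_X_c_pow k n a b c σ hc hab hac hbc 28
  have hr₂ : aeval tm₂ (σ (σ (g 23))) = X c ^ 28 * v₂' ^ 28 := by
    rw [hg23]; exact term_sigma_sigma_X_c_pow k n a b c σ hb hc hab hac hbc 28
  have hw0 : aeval tm₂ (g 23 * σ (g 23) * σ (σ (g 23))) ≠ 0 := by
    rw [hg23]; exact term_orbitNorm_X_c_pow_ne_zero k n a b c σ hb hc hab hac hbc 28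
  refine (exists_awayNorm_ringEquiv k n hab hac hbc g hg (σ (g 23)) (σ (σ (g 23))) h₁ h₂ hr₁ hr₂ s
    (mul_assoc _ _ _)).elim fun e₂ he₂ => ?_
  -- (4) fixed ↔ fixed through `e₂` (res-L1-w45c-stub-3's `terminal_map_away_fixed_iff`, part 4c)
  have hfixiff : ∀ y, σt (e₂ y) = e₂ y ↔ ∀ γ, HomogeneousLocalization.map (φ γ) (hP γ) y = y := fun y =>
    (terminal_map_away_fixed_iff k n a b c d σ hb hc hd hσ hab hac had hbc hbd s hs3 _ hsw hσw hw0 φ hφ hP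
      (e₂ : _ →+* L₂) e₂.injective (fun F => he₂ F) (σt : L₂ →ₐ[k] L₂) hC hA hB hD hfix y).symm
  -- (5) `S = L₂^⟨σ̃⟩`: finite type, regular, trivially graded
  haveI := finite_zpowers_terminalLift k n a b c σt hC hσt3
  haveI : Algebra.FiniteType (MvPolynomial (Fin n) k) L₂ :=
    IsLocalization.finiteType_of_monoid_fg (Submonoid.powers u₂) L₂
  haveI : Algebra.FiniteType k L₂ := Algebra.FiniteType.trans (S := MvPolynomial (Fin n) k) inferInstance
    inferInstance
  have hreg := terminalLift_fixedPoints_isRegularRing k n a b c d σt hC hA hB hD hfix hσt3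
  refine (PeelingFrame.exists_trivialGradedAlgebra k ↥(FixedPoints.subalgebra k L₂ ↥(Subgroup.zpowers σt))).elim
    fun 𝒮 h𝒮ex => h𝒮ex.elim fun h𝒮 h𝒮all => ?_
  have htop := h𝒮all.1
  -- (6) transport of the invariants along the seam
  let val : ↥(𝒮 0) →+* L₂ :=
    (FixedPoints.subalgebra k L₂ ↥(Subgroup.zpowers σt)).val.toRingHom.comp
      (algebraMap ↥(𝒮 0) ↥(FixedPoints.subalgebra k L₂ ↥(Subgroup.zpowers σt)))
  have hval : ∀ t, val t = ((t : ↥(FixedPoints.subalgebra k L₂ ↥(Subgroup.zpowers σt))) : L₂) :=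
    fun _ => rfl
  refine (exists_ringEquiv_invariants_of_seam
    (B := HomogeneousLocalization.Away (reesGrading (Ideal.span (Set.range g))) s) (P := L₂) (E := L₂)
    (T := ↥(𝒮 0)) Ω ((ρB.restrict P2.1 P2.2.1).invariants.ring ⊤)
    (fun y => ∀ γ, HomogeneousLocalization.map (φ γ) (hP γ) y = y) hinv e₂ (RingHom.id L₂)
    Function.injective_id (fun z => σt z = z) hfixiff val
    (fun s t h => by rw [hval, hval] at h; exact Subtype.ext (Subtype.ext h))
    (fun t => ((t : ↥(FixedPoints.subalgebra k L₂ ↥(Subgroup.zpowers σt))) : L₂)) (fun t => by rw [hval]; rfl)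
    (fun t => by rw [hval]; exact (TameTransfer.mem_fixedPoints_zpowers_iff_apply_eq σt _).mp t.1.2)
    (fun u hu => ⟨⟨u, (TameTransfer.mem_fixedPoints_zpowers_iff_apply_eq σt _).mpr hu⟩,
      by rw [htop]; exact Submodule.mem_top⟩)
    (fun u hu => by rw [hval]; rfl)).elim fun e he => ?_
  refine ⟨PUnit, inferInstance, inferInstance, inferInstance,
    ↥(FixedPoints.subalgebra k L₂ ↥(Subgroup.zpowers σt)), inferInstance, inferInstance, 𝒮, h𝒮,
    inferInstance, hreg, e, fun r => ?_⟩
  -- (7) compatibility with the `k`-structures (NB: no `rw` with a `Subtype.val`-headed pattern on the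
  -- main goal — it collides with `P2.1` and sends `whnf` into the scheme terms)
  have hC' : e₂.symm (((algebraMap k ↥(𝒮 0) r : ↥(𝒮 0)) :
      ↥(FixedPoints.subalgebra k L₂ ↥(Subgroup.zpowers σt))) : L₂) =
      ((fromZeroRingHom (reesGrading (Ideal.span (Set.range g))) (.powers s)).comp
        (reesGrading.zeroRingHom (Ideal.span (Set.range g)))) (C r) := by
    rw [SetLike.GradeZero.coe_algebraMap 𝒮 r,
      Subalgebra.coe_algebraMap (FixedPoints.subalgebra k L₂ ↥(Subgroup.zpowers σt)) r]
    apply e₂.injective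
    rw [e₂.apply_symm_apply, he₂, algHom_C, IsScalarTower.algebraMap_apply k (MvPolynomial (Fin n) k) L₂ r,
      MvPolynomial.algebraMap_eq]
  have hi := hΩi (MvPolynomial.C r)
  refine (he (algebraMap k (𝒮 0) r)).trans ?_
  beta_reduce
  rw [hC']
  conv_lhs => rw [hi]
  -- `q ≫ (Spec k-structure of 𝔸ⁿ/σ̄) = Spec (k → k[x])`, and the constant `r` through `Spec k → 𝔸ⁿ`
  have hqf : (qq σ) ≫ Spec.map (CommRingCat.ofHom (algebraMap k
      (FixedPoints.subalgebra k (MvPolynomial (Fin n) k) ↥(Subgroup.zpowers σ)))) =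
      Spec.map (CommRingCat.ofHom (algebraMap k (MvPolynomial (Fin n) k))) := by
    rw [← Spec.map_comp, ← CommRingCat.ofHom_comp, ← IsScalarTower.algebraMap_eq]
  have hz : (Spec.map (CommRingCat.ofHom (algebraMap k (MvPolynomial (Fin n) k)))).appLE ⊤ ⊤ le_top
      ((Scheme.ΓSpecIso (.of k)).inv r) =
      (Scheme.ΓSpecIso (.of (MvPolynomial (Fin n) k))).inv (MvPolynomial.C r) := by
    rw [appLE_top_ΓSpecIso_inv]; rfl
  exact (app_appLE_eq_of_comp_eq P2.1.ι (affineBlowup.π (Ideal.span (Set.range g))) (qq σ) _ _ hqf _ _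
    hz).symm

end Summit.ResolutionOfSingularities.ResolutionOfSingularities.Theorems.WildQuotientResolution.Z9Peeled.Terminal

end
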